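/-
Copyright (c) 2026 the pub-hodgecm-mathlib formalisation cell (harness21).  Prover seat hodgecm-mathlib-K2E3-p28 (g4) (S6 hand under dealer R90-C14-plan (g3)),
card (G2) «TYPE-(2) DISCHARGE», FILE 3♭-zero = the SHALLOW row `n = 0` (any `N`) of the RECORD target (E2♭) at every displacement `m`, from ONE named count — «E2♭-COUNT» (c)
`V₁(γ₁) = Σ_{k≤N} q^k` (F0P2-p09 (g3), road L, not yet ★); the odd class `V₁(γ₂) = 1` is ★ (b) ∘ ★ (G2-ODD) A (`Φ′ = phiTHprimen q 0 N = 0`).  THEOREMS ONLY (no `def`, no `instance`, no notation, no named-fact hypothesis, no `sorry`);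
lane `--supports stmt-HodgeConjecture-24833 --as helper` (count-neutral helper).
-/
import Summits.HodgeConjecture.HodgeConjecture.Theorems.R90S6EllipticIdentityTypeTwo                 -- ★ FILE 2 p865259 (this seat): `…_of_unitLevelOne`, `typeTwo_exponent_law`; brings FILE 1b, ★ a₀, ★ `v_disc_and_v_eval_of_ramifiedTorus`, ★ `map_mul_self_eq_one_of_mulVec_eq_smul`
import Summits.HodgeConjecture.HodgeConjecture.Theorems.R90S6TorusFixedSpecialCountTypeTwoShallowOne   -- ★ «E2♭-COUNT» (b) p865310 (K2Liu-p14) `natCard_fixedBy_special_eq_one_of_natCard_fixedBy_hyperspecial_eq_zero`; brings ★ `phiTHprimen_zero_left` (p865280)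
import Summits.HodgeConjecture.HodgeConjecture.Theorems.R90S6TorusFixedHyperspecialCountTypeTwoOdd    -- ★ (G2-ODD) A p864978 `natCard_fixedPoints_unitaryInt_eq_phiTHprimen_of_eigen_odd` (all depths)
import Literature.NumberTheory.Automorphic.UnitaryLatticeTreeLevelIndices                            -- ★ `index_inf_subgroupOf_eq_of_unramified` (`[K₀ : K₀ ⊓ K₁] = q³ + 1` ⇒ the rung-1 fibre instance)
import HarnessLib

/-!
# R90 · S6 — row E1.3.5.2.6, card (G2) FILE 3♭-zero: THE RAMIFIED TYPE-(2) ELLIPTIC κ-IDENTITY (E2♭) IN THE SHALLOW ROW `n = 0`, FROM ONE NAMED COUNT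
# (`Theorems/R90S6EllipticIdentityTypeTwoShallowZero.lean`)

Cell `hodgecm-mathlib`, crux H413 (`stmt-HodgeConjecture-24833`), route of record `HCCMUnconditional`; programme R90-TF, section S6 (base `R90-C14`, dealer
R90-C14-plan (g3)), seat K2E3-p28 (g4); card **(G2) «TYPE-(2) DISCHARGE»**, RECORD target (E2♭) = typ1 sheet v2.3 `4c174fca74d7a58a` :547 (the shallow regimes `n ≤ 1` of
the type-(2) identity; same conclusion bytes as (E2) :468).

THE MATHEMATICS.  ★ FILE 2 proved the identity at every `m` from ONE named anchor (U1₂) `Δ·(V₁(γ₁) − V₁(γ₂)) = Σ_{k≤N} q^k − 1` at every depth.  In the row `n = 0`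
(`|u − A| = 1`: the line eigenvalue is residually SEPARATED from the plane; `N ≥ 0` free) `Δ = (−q)^0 = 1`; the odd class has NO fixed hyperspecial vertex (★ (G2-ODD) A:
`V₀(γ₂) = phiTHprimen q 0 N = 0`, ★ `phiTHprimen_zero_left`) hence exactly ONE fixed special vertex (★ «E2♭-COUNT» (b)
`natCard_fixedBy_special_eq_one_of_natCard_fixedBy_hyperspecial_eq_zero`): `V₁(γ₂) = 1`; and the even class has `V₁(γ₁) = Σ_{k≤N} q^k` — «E2♭-COUNT» (c), the
plane Cayley ladder at `n = 0` (F0P2-p09 (g3), census 04:14:26Z; L-sized, not yet ★) — taken here as the ONE named hypothesis `hV₁`.  Then the anchor reads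
`1·(Σ_{k≤N} q^k − 1) = Σ_{k≤N} q^k − 1` (§1).  Rung-1 binders BUILT as in ★ FILE 3 ∕ 3♭-one.  HEAD `…_of_levelTop` (§2): (E2♭)'s binders with the regime letter
`hn_zero : n = 0` + `hV₁`, conclusion BYTES VERBATIM := ★ FILE 2 `…_of_unitLevelOne` ∘ §1.  Flicker's `n = 0` rows: `Φ − Φ′ = Φ_H(N) − 0`, `Δ = 1`.  With ★ FILE 3 (deep) and
FILE 3♭-one (`n = 1`), this is the LAST row of the type-(2) identity; it becomes hypothesis-free the minute (c) lands (one `exact`).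
HONEST LABEL: (E2♭) at `n = 0` for all `m` modulo ONE named count (c); proves no printed global statement by itself, discharges no citation, count-neutral until E1.3.5.2 ∕
E1.3.9 consume it.  HC_CM is proved only modulo the 7 printed citations (2 remaining named inputs: hLiu418 = stmt-HodgeConjecture-24832, h413 =
stmt-HodgeConjecture-24833) until rung 0 closes.

## References
* [Rogawski1990] J. D. Rogawski, *Automorphic Representations of Unitary Groups in Three Variables*, Ann. of Math. Stud. 123 (1990), §4.9 Prop. 4.9.1 (b) pp. 54–55;
  §3.6 Lemma 3.6.1 p. 28.
* [Flicker1998UnitaryFL] Y. Z. Flicker, *Elementary proof of the fundamental lemma for a unitary group*, Canad. J. Math. 50 (1998), Prop. 11 p. 87, Props. 16–17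
  pp. 96–97, Theorem 18 p. 97.
* [Kottwitz1986BaseChangeUnits] R. E. Kottwitz, *Base change for unit elements of Hecke algebras*, Compositio Math. 60 (1986), §1 pp. 240–241 (the Cayley shift).
* [Kottwitz1988] R. E. Kottwitz, *Tamagawa numbers*, Ann. of Math. 127 (1988), §2.  [Tits1979] J. Tits, *Reductive groups over local fields*, PSPM 33.1 (1979), §2.4, §3.3.3.
-/

set_option autoImplicit false
-- the mandated namespace repeats the single-problem summit's segment (`HodgeConjecture.HodgeConjecture`)
set_option linter.dupNamespace false

noncomputable section

open MulAction Finset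
open scoped Valued WithZero Matrix MatrixGroups
open Literature.NumberTheory.Automorphic Literature.NumberTheory.Automorphic.HermitianLattice Literature.NumberTheory.Automorphic.UnitaryGroup
open Literature.NumberTheory.Automorphic.UnitaryLatticeTree
open Literature.NumberTheory.Rogawski1990.Flicker1998 (phiTHprimen)
open IsLocalRing

namespace Summit.HodgeConjecture.HodgeConjecture.R90.S6

variable {K : Type} [Field K] [Valued K ℤᵐ⁰] [ValuativeRel K] [(Valued.v : Valuation K ℤᵐ⁰).Compatible] {σ : K →+* K} {ϖ : K}

/-! ## §1 The level-one anchor (U1₂) in the row `n = 0`: `Δ = 1`, `V₁(γ₂) = 1`, `V₁(γ₁)` named -/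

set_option synthInstance.maxHeartbeats 400000 in
set_option maxHeartbeats 1600000 in
-- the subgroup-quotient carriers `U₃ ⧸ K₀`, `U₃ ⧸ K₁`, `K₀ ⧸ (K₀ ⊓ K₁)` are slow to elaborate (same budgets as ★ «E2♭-COUNT» (a) ∕ ★ rung 1)
/-- **(U1₂) IN THE ROW `n = 0` FROM THE ONE NAMED COUNT (c)**: `(−q)^{log|(u−A)² − C²ρ|}·(#Fix_{γ₁}(U₃ ⧸ K₁) − #Fix_{γ₂}(U₃ ⧸ K₁)) = Σ_{k ≤ N} q^k − 1` — `Δ = 1`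
(`n = 0`), `#Fix_{γ₂}(U₃ ⧸ K₁) = 1` (★ (b) over ★ (G2-ODD) A's `#Fix_{γ₂}(U₃ ⧸ K₀) = phiTHprimen q 0 N = 0`), `#Fix_{γ₁}(U₃ ⧸ K₁) = Σ_{k≤N} q^k` = the hypothesis `hV₁` ((c),
F0P2-p09).  Rung-1 binders built as in ★ FILE 3. [cite: Flicker1998UnitaryFL, Theorem 18 p. 97; Prop. 17 p. 97] [cite: Kottwitz1988, §2] [cite: Rogawski1990, §4.9 Prop. 4.9.1 (b) p. 55] -/
theorem delta_mul_natCard_fixedBy_special_sub_eq_of_typeTwo_levelTop (hd : HermitianLattice.LocalConjDatum σ ϖ)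
    (hσO : ∀ x : 𝒪[K], σ x ∈ 𝒪[K]) (σk : 𝓀[K] →+* 𝓀[K])
    (hσk : ∀ x : 𝒪[K], IsLocalRing.residue 𝒪[K] ⟨σ x, hσO x⟩ = σk (IsLocalRing.residue 𝒪[K] x))
    [Fintype 𝓀[K]] {q : ℕ} (hq : Fintype.card 𝓀[K] = q ^ 2) (hfrob : ∀ y, σk y = y ^ q)
    {A C ρ u : K} {N n : ℕ} (hχ : Valued.v ((u - A) ^ 2 - C ^ 2 * ρ) = Valued.v (ϖ ^ n)) (hn_zero : n = 0)
    (γ₁ : unitaryGroupOfForm σ ((StdForm.antidiagonal 3).over K))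
    (γ₂ : unitaryGroupOfForm σ ((StdForm.antidiagonal 3).over K))
    {x₂ : Fin 3 → K} (hγ₂x : ((γ₂ : GL (Fin 3) K) : Matrix (Fin 3) (Fin 3) K) *ᵥ x₂ = u • x₂)
    {k₂ : ℤ} (hx₂ : Valued.v (HermitianLattice.B₀ σ 3 x₂ x₂) = WithZero.exp (2 * k₂ + 1))
    (hN₂ : Valued.v ((Matrix.trace ((γ₂ : GL (Fin 3) K) : Matrix (Fin 3) (Fin 3) K) - u) ^ 2 -
      4 * (Matrix.det ((γ₂ : GL (Fin 3) K) : Matrix (Fin 3) (Fin 3) K) / u)) = Valued.v (ϖ ^ (2 * N + 1)))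
    (hn₂ : Valued.v (u ^ 2 - (Matrix.trace ((γ₂ : GL (Fin 3) K) : Matrix (Fin 3) (Fin 3) K) - u) * u +
      Matrix.det ((γ₂ : GL (Fin 3) K) : Matrix (Fin 3) (Fin 3) K) / u) = Valued.v (ϖ ^ n))
    [IsDiscreteValuationRing 𝒪[K]] [IsAdicComplete (IsLocalRing.maximalIdeal 𝒪[K]) 𝒪[K]]
    {a₀ : 𝒪[K]} (ha₀ : IsUnit (((σ.comp 𝒪[K].subtype).codRestrict 𝒪[K] hσO) a₀ - a₀))
    (g₁ : GL (Fin 3) K) (hg₁ : (g₁ : Matrix (Fin 3) (Fin 3) K) = Matrix.diagonal ![(1 : K), 1, ϖ])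
    (hfin₀₂ : (fixedBy (↥(unitaryGroupOfForm σ ((StdForm.antidiagonal 3).over K)) ⧸
      (glInt 3 K).subgroupOf (unitaryGroupOfForm σ ((StdForm.antidiagonal 3).over K))) γ₂).Finite)
    (hfin₁₂ : (fixedBy (↥(unitaryGroupOfForm σ ((StdForm.antidiagonal 3).over K)) ⧸
      ((glInt 3 K).map (MulAut.conj g₁).toMonoidHom).subgroupOf (unitaryGroupOfForm σ ((StdForm.antidiagonal 3).over K))) γ₂).Finite)
    (horb₂ : (Set.range fun n : ℕ => ((γ₂ ^ n : ↥(unitaryGroupOfForm σ ((StdForm.antidiagonal 3).over K))) :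
      ↥(unitaryGroupOfForm σ ((StdForm.antidiagonal 3).over K)) ⧸ (glInt 3 K).subgroupOf (unitaryGroupOfForm σ ((StdForm.antidiagonal 3).over K)))).Finite)
    -- the ONE named count: «E2♭-COUNT» (c) (F0P2-p09 (g3)), even class at `n = 0`
    (hV₁ : Nat.card (fixedBy (↥(unitaryGroupOfForm σ ((StdForm.antidiagonal 3).over K)) ⧸
      ((glInt 3 K).map (MulAut.conj g₁).toMonoidHom).subgroupOf (unitaryGroupOfForm σ ((StdForm.antidiagonal 3).over K))) γ₁) = ∑ k ∈ Finset.range (N + 1), q ^ k) :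
    (-(q : ℂ)) ^ WithZero.log (Valued.v ((u - A) ^ 2 - C ^ 2 * ρ)) *
        ((Nat.card (fixedBy (↥(unitaryGroupOfForm σ ((StdForm.antidiagonal 3).over K)) ⧸
            ((glInt 3 K).map (MulAut.conj g₁).toMonoidHom).subgroupOf (unitaryGroupOfForm σ ((StdForm.antidiagonal 3).over K))) γ₁) : ℂ) -
          (Nat.card (fixedBy (↥(unitaryGroupOfForm σ ((StdForm.antidiagonal 3).over K)) ⧸
            ((glInt 3 K).map (MulAut.conj g₁).toMonoidHom).subgroupOf (unitaryGroupOfForm σ ((StdForm.antidiagonal 3).over K))) γ₂) : ℂ)) =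
      ((∑ k ∈ Finset.range (N + 1), q ^ k : ℕ) : ℂ) - 1 := by
  classical
  have hq1 : 1 < q := one_lt_of_card_residueField_eq_sq hq
  have hqNat : Nat.card (IsLocalRing.ResidueField 𝒪[K]) = q ^ 2 := by rw [Nat.card_eq_fintype_card]; exact hq
  -- the built binders of ★ rung 1: `Fintype (Fix(U₃ ⧸ K₀))`, the section `r`, the fibre finiteness (`[K₀ : K₀ ⊓ K₁] = q³ + 1`)
  haveI : Fintype (fixedBy (↥(unitaryGroupOfForm σ ((StdForm.antidiagonal 3).over K)) ⧸
      (glInt 3 K).subgroupOf (unitaryGroupOfForm σ ((StdForm.antidiagonal 3).over K))) γ₂) := hfin₀₂.fintype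
  haveI : (((glInt 3 K).subgroupOf (unitaryGroupOfForm σ ((StdForm.antidiagonal 3).over K)) ⊓
      ((glInt 3 K).map (MulAut.conj g₁).toMonoidHom).subgroupOf (unitaryGroupOfForm σ ((StdForm.antidiagonal 3).over K))).subgroupOf
      ((glInt 3 K).subgroupOf (unitaryGroupOfForm σ ((StdForm.antidiagonal 3).over K)))).FiniteIndex :=
    ⟨by rw [(index_inf_subgroupOf_eq_of_unramified hd.toUnramified hσO σk hσk hq hfrob g₁ hg₁).1]; exact Nat.succ_ne_zero _⟩
  haveI : Finite (↥((glInt 3 K).subgroupOf (unitaryGroupOfForm σ ((StdForm.antidiagonal 3).over K))) ⧸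
      (((glInt 3 K).subgroupOf (unitaryGroupOfForm σ ((StdForm.antidiagonal 3).over K)) ⊓
        ((glInt 3 K).map (MulAut.conj g₁).toMonoidHom).subgroupOf (unitaryGroupOfForm σ ((StdForm.antidiagonal 3).over K))).subgroupOf
        ((glInt 3 K).subgroupOf (unitaryGroupOfForm σ ((StdForm.antidiagonal 3).over K))))) :=
    Subgroup.finite_quotient_of_finiteIndex
  set r : ↥(unitaryGroupOfForm σ ((StdForm.antidiagonal 3).over K)) ⧸ (glInt 3 K).subgroupOf (unitaryGroupOfForm σ ((StdForm.antidiagonal 3).over K)) →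
      ↥(unitaryGroupOfForm σ ((StdForm.antidiagonal 3).over K)) := Quotient.out with hrdef
  have hr : Function.RightInverse r QuotientGroup.mk := fun z => Quotient.out_eq z
  -- the odd class: no fixed hyperspecial vertex (★ (G2-ODD) A at `n = 0`), hence one fixed special vertex (★ (b))
  have hA := natCard_fixedPoints_unitaryInt_eq_phiTHprimen_of_eigen_odd σ rfl hd hσO hqNat hq1 ha₀ hγ₂x hx₂ hN₂ hn₂
  rw [unitaryInt_eq_glInt_subgroupOf, hn_zero, phiTHprimen_zero_left] at hA
  change (Nat.card (fixedBy (↥(unitaryGroupOfForm σ ((StdForm.antidiagonal 3).over K)) ⧸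
      (glInt 3 K).subgroupOf (unitaryGroupOfForm σ ((StdForm.antidiagonal 3).over K))) γ₂) : ℚ) = 0 at hA
  have hV₀₂ : Nat.card (fixedBy (↥(unitaryGroupOfForm σ ((StdForm.antidiagonal 3).over K)) ⧸
      (glInt 3 K).subgroupOf (unitaryGroupOfForm σ ((StdForm.antidiagonal 3).over K))) γ₂) = 0 := by exact_mod_cast hA
  have hV₁₂ := natCard_fixedBy_special_eq_one_of_natCard_fixedBy_hyperspecial_eq_zero hd.toUnramified g₁ hg₁ γ₂ hfin₁₂ horb₂ r hr hV₀₂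
  -- `Δ = 1` at `n = 0`
  rw [hV₁, hV₁₂, log_v_typeTwo_eq_neg hd hχ, hn_zero, Nat.cast_zero, neg_zero, zpow_zero, one_mul]
  push_cast
  ring

/-! ## §2 HEAD: (E2♭) in the row `n = 0` at every displacement, from the one named count (c) -/

set_option synthInstance.maxHeartbeats 400000 in
set_option maxHeartbeats 1600000 in
-- same carriers as §1
/-- **(G2) THE RAMIFIED TYPE-(2) ELLIPTIC κ-IDENTITY (E2♭), ROW `n = 0` (any `N`), AT EVERY `m` — FROM ONE NAMED COUNT.**  Binders = the RECORD head's own (v2.3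
:468∕:547), VERBATIM and in order, with the regime letter `hn_zero : n = 0` in place of `hn2 hN1` ∕ `hn1`, minus the H-side root `x₀ hx₀`, plus the ONE named hypothesis
`hV₁ : #Fix_{γ₁}(U₃ ⧸ K₁) = Σ_{k≤N} q^k` («E2♭-COUNT» (c)); conclusion = :468's conclusion BYTES VERBATIM.  Proof: ★ FILE 2 `…_of_unitLevelOne` with `hU1` := §1.
[cite: Rogawski1990, §4.9 Prop. 4.9.1 (b) pp. 54–55; §3.6 Lemma 3.6.1 p. 28] [cite: Flicker1998UnitaryFL, Theorem 18 p. 97; Prop. 11 p. 87; Props. 16–17 pp. 96–97]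
[cite: Kottwitz1986BaseChangeUnits, §1 pp. 240–241] [cite: LabesseLanglands1979, §§2–3] -/
theorem delta_mul_kappaDiff_ncard_displaced_typeTwo_eq_sum_xiHCoeff_mul_ncard_displaced_two_of_levelTop
    (hd : HermitianLattice.LocalConjDatum σ ϖ)
    (hσO : ∀ x : 𝒪[K], σ x ∈ 𝒪[K]) (σk : 𝓀[K] →+* 𝓀[K])
    (hσk : ∀ x : 𝒪[K], IsLocalRing.residue 𝒪[K] ⟨σ x, hσO x⟩ = σk (IsLocalRing.residue 𝒪[K] x))
    [Fintype 𝓀[K]] {q : ℕ} (hq : Fintype.card 𝓀[K] = q ^ 2) (hfrob : ∀ y, σk y = y ^ q)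
    {A C ρ u : K} (hvρ : Valued.v ρ = Valued.v ϖ) {N n : ℕ} (hvC : Valued.v C = Valued.v (ϖ ^ N))
    (hχ : Valued.v ((u - A) ^ 2 - C ^ 2 * ρ) = Valued.v (ϖ ^ n)) (hn_zero : n = 0)
    (γ₁ : unitaryGroupOfForm σ ((StdForm.antidiagonal 3).over K))
    (hγ₁ : ((γ₁ : GL (Fin 3) K) : Matrix (Fin 3) (Fin 3) K) = !![A, 0, C * ρ; 0, u, 0; C, 0, A])
    (γ₂ : unitaryGroupOfForm σ ((StdForm.antidiagonal 3).over K))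
    {x₂ : Fin 3 → K} (hγ₂x : ((γ₂ : GL (Fin 3) K) : Matrix (Fin 3) (Fin 3) K) *ᵥ x₂ = u • x₂)
    {k₂ : ℤ} (hx₂ : Valued.v (HermitianLattice.B₀ σ 3 x₂ x₂) = WithZero.exp (2 * k₂ + 1))
    (hN₂ : Valued.v ((Matrix.trace ((γ₂ : GL (Fin 3) K) : Matrix (Fin 3) (Fin 3) K) - u) ^ 2 -
      4 * (Matrix.det ((γ₂ : GL (Fin 3) K) : Matrix (Fin 3) (Fin 3) K) / u)) = Valued.v (ϖ ^ (2 * N + 1)))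
    (hn₂ : Valued.v (u ^ 2 - (Matrix.trace ((γ₂ : GL (Fin 3) K) : Matrix (Fin 3) (Fin 3) K) - u) * u +
      Matrix.det ((γ₂ : GL (Fin 3) K) : Matrix (Fin 3) (Fin 3) K) / u) = Valued.v (ϖ ^ n))
    (δ : unitaryGroupOfForm σ ((StdForm.antidiagonal 2).over K))
    (hδ : ((δ : GL (Fin 2) K) : Matrix (Fin 2) (Fin 2) K) = !![A, C * ρ; C, A])
    [IsDiscreteValuationRing 𝒪[K]] [IsAdicComplete (IsLocalRing.maximalIdeal 𝒪[K]) 𝒪[K]]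
    {y : K} (hy : y * σ y = -2)
    {cW : ↥(unitaryGroupOfForm σ ((StdForm.antidiagonal 3).over K))} (hcW : ((cW : GL (Fin 3) K) : Matrix (Fin 3) (Fin 3) K) = !![1, 0, 0; 0, -1, 0; 0, 0, 1])
    (um : ℕ → ↥(unitaryGroupOfForm σ ((StdForm.antidiagonal 3).over K)))
    (hum : ∀ m, ((um m : GL (Fin 3) K) : Matrix (Fin 3) (Fin 3) K) = !![ϖ ^ m, y, (ϖ ^ m)⁻¹; 0, 1, -σ y * (ϖ ^ m)⁻¹; 0, 0, (ϖ ^ m)⁻¹])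
    {R : Type} [CommRing R] [IsDomain R] [IsDiscreteValuationRing R] [Finite (IsLocalRing.ResidueField R)] [IsAdicComplete (IsLocalRing.maximalIdeal R) R]
    (ι : R →+* K) (hι : Function.Injective ι)
    (hιv : ∀ x : K, Valued.v x ≤ 1 ↔ x ∈ Set.range ι) (σR : R →+* R) (hσR : ∀ r, σR (σR r) = r) (hσι : ∀ r, ι (σR r) = σ (ι r))
    {dR : R} (hdRσ : σR dR = -dR) (hdRu : IsUnit dR) (h2R : IsUnit (2 : R)) {ϖR : R} (hϖR : Irreducible ϖR) (hιϖ : ι ϖR = ϖ)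
    (hqR : Nat.card (IsLocalRing.ResidueField R) = q ^ 2)
    {a₀ : 𝒪[K]} (ha₀ : IsUnit (((σ.comp 𝒪[K].subtype).codRestrict 𝒪[K] hσO) a₀ - a₀))
    (g₁ : GL (Fin 3) K) (hg₁ : (g₁ : Matrix (Fin 3) (Fin 3) K) = Matrix.diagonal ![(1 : K), 1, ϖ])
    (hfin₀₁ : (fixedBy (↥(unitaryGroupOfForm σ ((StdForm.antidiagonal 3).over K)) ⧸
      (glInt 3 K).subgroupOf (unitaryGroupOfForm σ ((StdForm.antidiagonal 3).over K))) γ₁).Finite)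
    (hfin₁₁ : (fixedBy (↥(unitaryGroupOfForm σ ((StdForm.antidiagonal 3).over K)) ⧸
      ((glInt 3 K).map (MulAut.conj g₁).toMonoidHom).subgroupOf (unitaryGroupOfForm σ ((StdForm.antidiagonal 3).over K))) γ₁).Finite)
    (horb₁ : (Set.range fun n : ℕ => ((γ₁ ^ n : ↥(unitaryGroupOfForm σ ((StdForm.antidiagonal 3).over K))) :
      ↥(unitaryGroupOfForm σ ((StdForm.antidiagonal 3).over K)) ⧸ (glInt 3 K).subgroupOf (unitaryGroupOfForm σ ((StdForm.antidiagonal 3).over K)))).Finite)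
    (hfin₀₂ : (fixedBy (↥(unitaryGroupOfForm σ ((StdForm.antidiagonal 3).over K)) ⧸
      (glInt 3 K).subgroupOf (unitaryGroupOfForm σ ((StdForm.antidiagonal 3).over K))) γ₂).Finite)
    (hfin₁₂ : (fixedBy (↥(unitaryGroupOfForm σ ((StdForm.antidiagonal 3).over K)) ⧸
      ((glInt 3 K).map (MulAut.conj g₁).toMonoidHom).subgroupOf (unitaryGroupOfForm σ ((StdForm.antidiagonal 3).over K))) γ₂).Finite)
    (horb₂ : (Set.range fun n : ℕ => ((γ₂ ^ n : ↥(unitaryGroupOfForm σ ((StdForm.antidiagonal 3).over K))) :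
      ↥(unitaryGroupOfForm σ ((StdForm.antidiagonal 3).over K)) ⧸ (glInt 3 K).subgroupOf (unitaryGroupOfForm σ ((StdForm.antidiagonal 3).over K)))).Finite)
    (hloc : ∀ v, ((HermitianLatticeTree.latticeTree σ ϖ ((StdForm.antidiagonal 2).over K)).neighborSet v).Finite)
    (hreg : ∀ v, ((HermitianLatticeTree.latticeTree σ ϖ ((StdForm.antidiagonal 2).over K)).neighborSet v).ncard = q + 1)
    -- the ONE named count: «E2♭-COUNT» (c) (F0P2-p09 (g3)), even class at `n = 0`
    (hV₁ : Nat.card (fixedBy (↥(unitaryGroupOfForm σ ((StdForm.antidiagonal 3).over K)) ⧸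
      ((glInt 3 K).map (MulAut.conj g₁).toMonoidHom).subgroupOf (unitaryGroupOfForm σ ((StdForm.antidiagonal 3).over K))) γ₁) = ∑ k ∈ Finset.range (N + 1), q ^ k)
    (m : ℕ) :
    (-(q : ℂ)) ^ WithZero.log (Valued.v ((u - A) ^ 2 - C ^ 2 * ρ)) *
        (({x : {M : Submodule 𝒪[K] (Fin 3 → K) // UnitaryLatticeTree.IsVertex σ ϖ ((StdForm.antidiagonal 3).over K) M} |
              UnitaryLatticeTree.IsSelfDualLattice σ ϖ ((StdForm.antidiagonal 3).over K) x.1 ∧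
                (UnitaryLatticeTree.latticeGraph σ ϖ ((StdForm.antidiagonal 3).over K)).dist x
                  (UnitaryLatticeTree.latticeGraphPerm σ ϖ ((StdForm.antidiagonal 3).over K) γ₁ x) = 2 * m}.ncard : ℂ) -
          ({x : {M : Submodule 𝒪[K] (Fin 3 → K) // UnitaryLatticeTree.IsVertex σ ϖ ((StdForm.antidiagonal 3).over K) M} |
              UnitaryLatticeTree.IsSelfDualLattice σ ϖ ((StdForm.antidiagonal 3).over K) x.1 ∧
                (UnitaryLatticeTree.latticeGraph σ ϖ ((StdForm.antidiagonal 3).over K)).dist x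
                  (UnitaryLatticeTree.latticeGraphPerm σ ϖ ((StdForm.antidiagonal 3).over K) γ₂ x) = 2 * m}.ncard : ℂ)) =
      ∑ k ∈ Finset.range (m + 1), xiHCoeff q m k *
          ({x : {M : Submodule (ValuativeRel.valuation K).integer (Fin 2 → K) // HermitianLatticeTree.IsSpecialLattice σ ϖ ((StdForm.antidiagonal 2).over K) M} |
              HermitianLatticeTree.IsSelfDualLattice σ ((StdForm.antidiagonal 2).over K) x.1 ∧
                (HermitianLatticeTree.latticeTree σ ϖ ((StdForm.antidiagonal 2).over K)).dist x
                  (HermitianLatticeTree.latticeTreeIso σ ϖ ((StdForm.antidiagonal 2).over K) δ x) = 2 * k}.ncard : ℂ) :=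
  delta_mul_kappaDiff_ncard_displaced_typeTwo_eq_sum_xiHCoeff_mul_ncard_displaced_two_of_unitLevelOne hd hσO σk hσk hq hfrob hvρ hvC hχ γ₁ hγ₁ γ₂ hγ₂x hx₂ hN₂ hn₂
    δ hδ hy hcW um hum ι hι hιv σR hσR hσι hdRσ hdRu h2R hϖR hιϖ hqR ha₀ g₁ hg₁ hfin₀₁ hfin₁₁ horb₁ hfin₀₂ hfin₁₂ horb₂ hloc hreg
    (delta_mul_natCard_fixedBy_special_sub_eq_of_typeTwo_levelTop hd hσO σk hσk hq hfrob hχ hn_zero γ₁ γ₂ hγ₂x hx₂ hN₂ hn₂ ha₀ g₁ hg₁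
      hfin₀₂ hfin₁₂ horb₂ hV₁) m

end Summit.HodgeConjecture.HodgeConjecture.R90.S6

end
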